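import Literature.MathematicalPhysics.QuantumLattice.YangMillsHeatFlowEnergyInterval
import HarnessLib

/-!
# Yang–Mills heat flow: the semilinear heat hypothesis in textbook form

Sorry-free progress on the named fact
`Literature.MathematicalPhysics.QuantumLattice.Waldron2019_yangMillsFlow_flatTorus` (Waldron 2019,
Cor. 1.2 with Struwe's short-time existence). In `YangMillsHeatFlowDeTurck.lean` /
`YangMillsHeatFlowEnergyInterval.lean` the named fact was reduced to Waldron's Thm. 1.1 (verbatim)
and a semilinear parabolic existence hypothesis `hSL` whose formulation still carried one
non-standard clause: the unknown was `(ℝ⁴ →L 𝔸)`-valued and was required to stay valued in a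
subspace `𝔤 ⊆ 𝔸` preserved by the nonlinearity (for the DeTurck flow, `𝔤 = 𝔲(N)`). This file
removes that clause: the textbook statement — local well-posedness of
`∂ₜ u = Σ_μ ∂_μ∂_μ u + f(x, u, ∂u)` on the flat torus for maps with values in an arbitrary
finite-dimensional real normed space `V`, smooth periodic `f` and data (Taylor, *PDE III*, Ch. 15,
§1) — implies the clause-carrying form, by solving in `V = (ℝ⁴ →L ↥𝔤)` the system compressed by
a continuous linear projection `𝔸 → 𝔤` and re-embedding (`semilinearHeat_subspace_of_free`;
`fderiv_clm_postcomp`, `fderiv_fderiv_clm_postcomp_apply`). Combined with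
`Waldron2019_yangMillsFlow_flatTorus_of_semilinearHeatCoord_of_thm11`
(`YangMillsHeatFlowEnergyInterval.lean`) this gives
`Waldron2019_yangMillsFlow_flatTorus_of_semilinearHeatFree_of_thm11`: **the named fact follows
from the textbook semilinear heat theorem and Waldron's Thm. 1.1, each taken in its published
form**, everything else being proved in this directory. No definition, no named fact.

References: M. E. Taylor, *Partial Differential Equations III* (2011), Ch. 15, §1
[TaylorPDEIII2011]; A. Waldron, Invent. Math. 217 (2019), Thm. 1.1, Cor. 1.2 [Waldron2019];
M. Struwe, Calc. Var. 2 (1994), §4.1 [Struwe1994]; S. K. Donaldson, P. B. Kronheimer, *The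
Geometry of Four-Manifolds* (1990), §6.3.1 [DonaldsonKronheimer1990].
-/

noncomputable section

set_option maxSynthPendingDepth 3

open scoped ContDiff Topology
open Set Filter

namespace Literature.MathematicalPhysics.QuantumLattice

/-! ### Post-composition with a continuous linear map commutes with derivatives -/

section PostComp

variable {X : Type*} [NormedAddCommGroup X] [NormedSpace ℝ X]
variable {V : Type*} [NormedAddCommGroup V] [NormedSpace ℝ V]
variable {V' : Type*} [NormedAddCommGroup V'] [NormedSpace ℝ V']

/-- `D(Λ ∘ g)(x) = Λ ∘ Dg(x)` for a continuous linear `Λ` and differentiable `g`. [folklore] -/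
theorem fderiv_clm_postcomp (Λ : V →L[ℝ] V') {g : X → V} {x : X} (hg : DifferentiableAt ℝ g x) :
    fderiv ℝ (fun y => Λ (g y)) x = Λ.comp (fderiv ℝ g x) :=
  (Λ.hasFDerivAt.comp x hg.hasFDerivAt).fderiv

/-- `D²(Λ ∘ g)(x)(w, w') = Λ (D²g(x)(w, w'))` for a continuous linear `Λ` and `C²` `g`. [folklore] -/
theorem fderiv_fderiv_clm_postcomp_apply (Λ : V →L[ℝ] V') {g : X → V} (hg : ContDiff ℝ 2 g)
    (x w w' : X) :
    fderiv ℝ (fderiv ℝ (fun y => Λ (g y))) x w w' = Λ (fderiv ℝ (fderiv ℝ g) x w w') := by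
  have hd : ∀ y, DifferentiableAt ℝ g y := fun y => hg.differentiable two_ne_zero y
  have h1 : (fderiv ℝ (fun y => Λ (g y))) = fun y =>
      (ContinuousLinearMap.compL ℝ X V V' Λ) (fderiv ℝ g y) := by
    funext y
    rw [fderiv_clm_postcomp Λ (hd y), ContinuousLinearMap.compL_apply]
  have hd' : DifferentiableAt ℝ (fderiv ℝ g) x :=
    ((hg.fderiv_right (m := 1) le_rfl).differentiable one_ne_zero) x
  rw [h1, fderiv_clm_postcomp _ hd']
  simp [ContinuousLinearMap.compL_apply]

end PostComp

/-! ### From the subspace-free semilinear hypothesis to the form with an invariant subspace -/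

section SubspaceFree

variable {𝔸 : Type} [NormedRing 𝔸] [NormedAlgebra ℝ 𝔸] [FiniteDimensional ℝ 𝔸]

set_option maxHeartbeats 800000 in
/-- **The invariant-subspace clause is free.** Local well-posedness of semilinear heat systems
`∂ₜ u = Σ_μ ∂_μ∂_μ u + f(x, u, ∂u)` on the flat torus for maps with values in an ARBITRARY
finite-dimensional real normed space `V` (hypothesis `hSL`, the textbook statement; Taylor,
*PDE III*, Ch. 15, §1) implies the form used by `shortTime_of_semilinearHeat_coord`, in which the
unknown is `(ℝ⁴ →L 𝔸)`-valued, the nonlinearity preserves jets with values in a subspace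
`𝔤 ⊆ 𝔸`, and the solution is required to stay `𝔤`-valued: apply `hSL` with
`V = (ℝ⁴ →L ↥𝔤)` to the nonlinearity compressed by a continuous linear projection `π : 𝔸 → 𝔤`
(`𝔤` is complemented, `𝔸` being finite-dimensional) and re-embed the solution by the inclusion
`ι : 𝔤 → 𝔸`; derivatives commute with `ι`, and on `𝔤`-valued jets `ι ∘ π ∘ f = f`. [folklore] -/
theorem semilinearHeat_subspace_of_free
    (hSL : ∀ {V : Type} [NormedAddCommGroup V] [NormedSpace ℝ V] [FiniteDimensional ℝ V]
      (L : ℝ), 0 < L →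
      ∀ f : EuclideanSpace ℝ (Fin 4) × V × (EuclideanSpace ℝ (Fin 4) →L[ℝ] V) → V,
        ContDiff ℝ ∞ f →
        (∀ (x : EuclideanSpace ℝ (Fin 4)) (i : Fin 4) (a : V) (p : EuclideanSpace ℝ (Fin 4) →L[ℝ] V),
          f (x + EuclideanSpace.single i L, a, p) = f (x, a, p)) →
        ∀ u₀ : EuclideanSpace ℝ (Fin 4) → V, ContDiff ℝ ∞ u₀ →
          (∀ (x : EuclideanSpace ℝ (Fin 4)) (i : Fin 4), u₀ (x + EuclideanSpace.single i L) = u₀ x) →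
          ∃ ε : ℝ, 0 < ε ∧ ∃ u : ℝ → EuclideanSpace ℝ (Fin 4) → V,
            u 0 = u₀ ∧
            ContDiffOn ℝ ∞ (fun p : ℝ × EuclideanSpace ℝ (Fin 4) => u p.1 p.2) (Ico 0 ε ×ˢ univ) ∧
            (∀ t : ℝ, 0 ≤ t → t < ε → ∀ (x : EuclideanSpace ℝ (Fin 4)) (i : Fin 4),
              u t (x + EuclideanSpace.single i L) = u t x) ∧
            ∀ t : ℝ, 0 < t → t < ε → ∀ x : EuclideanSpace ℝ (Fin 4),
              deriv (fun s => u s x) t =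
                (∑ i, fderiv ℝ (fderiv ℝ (u t)) x (EuclideanSpace.basisFun (Fin 4) ℝ i)
                  (EuclideanSpace.basisFun (Fin 4) ℝ i)) +
                f (x, u t x, fderiv ℝ (u t) x))
    (𝔤 : Submodule ℝ 𝔸) (L : ℝ) (hL : 0 < L)
    (f : EuclideanSpace ℝ (Fin 4) × (EuclideanSpace ℝ (Fin 4) →L[ℝ] 𝔸) ×
      (EuclideanSpace ℝ (Fin 4) →L[ℝ] EuclideanSpace ℝ (Fin 4) →L[ℝ] 𝔸) →
      (EuclideanSpace ℝ (Fin 4) →L[ℝ] 𝔸))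
    (hf : ContDiff ℝ ∞ f)
    (hfp : ∀ (x : EuclideanSpace ℝ (Fin 4)) (i : Fin 4) (a : EuclideanSpace ℝ (Fin 4) →L[ℝ] 𝔸)
      (p : EuclideanSpace ℝ (Fin 4) →L[ℝ] EuclideanSpace ℝ (Fin 4) →L[ℝ] 𝔸),
      f (x + EuclideanSpace.single i L, a, p) = f (x, a, p))
    (hfg : ∀ (x : EuclideanSpace ℝ (Fin 4)) (a : EuclideanSpace ℝ (Fin 4) →L[ℝ] 𝔸)
      (p : EuclideanSpace ℝ (Fin 4) →L[ℝ] EuclideanSpace ℝ (Fin 4) →L[ℝ] 𝔸),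
      (∀ v, a v ∈ 𝔤) → (∀ u v, p u v ∈ 𝔤) → ∀ v, f (x, a, p) v ∈ 𝔤)
    (u₀ : Connection (EuclideanSpace ℝ (Fin 4)) 𝔸) (hu₀ : IsSmoothConnection u₀)
    (hu₀v : u₀.IsValuedIn 𝔤) (hu₀p : u₀.IsLatticePeriodic L) :
    ∃ ε : ℝ, 0 < ε ∧ ∃ u : ℝ → Connection (EuclideanSpace ℝ (Fin 4)) 𝔸,
      u 0 = u₀ ∧
      ContDiffOn ℝ ∞ (fun p : ℝ × EuclideanSpace ℝ (Fin 4) => u p.1 p.2) (Ico 0 ε ×ˢ univ) ∧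
      (∀ t : ℝ, 0 ≤ t → t < ε → (u t).IsLatticePeriodic L) ∧
      (∀ t : ℝ, 0 ≤ t → t < ε → (u t).IsValuedIn 𝔤) ∧
      ∀ t : ℝ, 0 < t → t < ε → ∀ x v : EuclideanSpace ℝ (Fin 4),
        deriv (fun s => u s x v) t =
          (∑ i, fderiv ℝ (fderiv ℝ (u t)) x (EuclideanSpace.basisFun (Fin 4) ℝ i)
            (EuclideanSpace.basisFun (Fin 4) ℝ i)) v +
          f (x, u t x, fderiv ℝ (u t) x) v := by
  -- a continuous linear projection onto `𝔤` and the inclusion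
  have h𝔤c : IsClosed (𝔤 : Set 𝔸) := 𝔤.closed_of_finiteDimensional
  obtain ⟨π, hπ⟩ : 𝔤.ClosedComplemented :=
    Submodule.ClosedComplemented.of_finiteDimensional_quotient h𝔤c
  set ι : 𝔤 →L[ℝ] 𝔸 := 𝔤.subtypeL with hι
  -- post-composition operators on 1-forms and on 2-jets
  set ιL : (EuclideanSpace ℝ (Fin 4) →L[ℝ] 𝔤) →L[ℝ] (EuclideanSpace ℝ (Fin 4) →L[ℝ] 𝔸) :=
    ContinuousLinearMap.compL ℝ (EuclideanSpace ℝ (Fin 4)) 𝔤 𝔸 ι with hιL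
  set πL : (EuclideanSpace ℝ (Fin 4) →L[ℝ] 𝔸) →L[ℝ] (EuclideanSpace ℝ (Fin 4) →L[ℝ] 𝔤) :=
    ContinuousLinearMap.compL ℝ (EuclideanSpace ℝ (Fin 4)) 𝔸 𝔤 π with hπL
  set ιLL : (EuclideanSpace ℝ (Fin 4) →L[ℝ] EuclideanSpace ℝ (Fin 4) →L[ℝ] 𝔤) →L[ℝ]
      (EuclideanSpace ℝ (Fin 4) →L[ℝ] EuclideanSpace ℝ (Fin 4) →L[ℝ] 𝔸) :=
    ContinuousLinearMap.compL ℝ (EuclideanSpace ℝ (Fin 4)) _ _ ιL with hιLL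
  have hιL_apply : ∀ (a : EuclideanSpace ℝ (Fin 4) →L[ℝ] 𝔤) (v : EuclideanSpace ℝ (Fin 4)),
      ιL a v = (a v : 𝔸) := fun a v => rfl
  have hιLL_apply : ∀ (p : EuclideanSpace ℝ (Fin 4) →L[ℝ] EuclideanSpace ℝ (Fin 4) →L[ℝ] 𝔤)
      (w v : EuclideanSpace ℝ (Fin 4)), ιLL p w v = (p w v : 𝔸) := fun p w v => rfl
  -- `ι ∘ π` is the identity on `𝔤`-valued forms
  have hιπ : ∀ (a : EuclideanSpace ℝ (Fin 4) →L[ℝ] 𝔸), (∀ v, a v ∈ 𝔤) → ιL (πL a) = a := by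
    intro a ha
    ext v
    exact congrArg Subtype.val (hπ ⟨a v, ha v⟩)
  -- the compressed nonlinearity and data
  set f' : EuclideanSpace ℝ (Fin 4) × (EuclideanSpace ℝ (Fin 4) →L[ℝ] 𝔤) ×
      (EuclideanSpace ℝ (Fin 4) →L[ℝ] EuclideanSpace ℝ (Fin 4) →L[ℝ] 𝔤) →
      (EuclideanSpace ℝ (Fin 4) →L[ℝ] 𝔤) := fun q => πL (f (q.1, ιL q.2.1, ιLL q.2.2)) with hf'
  have hf's : ContDiff ℝ ∞ f' := by
    have hJ : ContDiff ℝ ∞ fun q : EuclideanSpace ℝ (Fin 4) × (EuclideanSpace ℝ (Fin 4) →L[ℝ] 𝔤) ×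
        (EuclideanSpace ℝ (Fin 4) →L[ℝ] EuclideanSpace ℝ (Fin 4) →L[ℝ] 𝔤) =>
        (q.1, ιL q.2.1, ιLL q.2.2) :=
      contDiff_fst.prodMk ((ιL.contDiff.comp (contDiff_snd.fst)).prodMk
        (ιLL.contDiff.comp (contDiff_snd.snd)))
    exact πL.contDiff.comp (hf.comp hJ)
  have hf'p : ∀ (x : EuclideanSpace ℝ (Fin 4)) (i : Fin 4) (a : EuclideanSpace ℝ (Fin 4) →L[ℝ] 𝔤)
      (p : EuclideanSpace ℝ (Fin 4) →L[ℝ] EuclideanSpace ℝ (Fin 4) →L[ℝ] 𝔤),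
      f' (x + EuclideanSpace.single i L, a, p) = f' (x, a, p) := by
    intro x i a p
    simp only [hf', hfp]
  set u₀' : EuclideanSpace ℝ (Fin 4) → (EuclideanSpace ℝ (Fin 4) →L[ℝ] 𝔤) := fun x => πL (u₀ x)
    with hu₀'
  have hu₀'s : ContDiff ℝ ∞ u₀' := πL.contDiff.comp hu₀
  have hu₀'p : ∀ (x : EuclideanSpace ℝ (Fin 4)) (i : Fin 4),
      u₀' (x + EuclideanSpace.single i L) = u₀' x := by
    intro x i
    simp only [hu₀', hu₀p x i]
  -- solve the compressed system
  obtain ⟨ε, hε, u', hu'0, hu's, hu'p, hu'pde⟩ := hSL L hL f' hf's hf'p u₀' hu₀'s hu₀'p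
  -- re-embed
  set u : ℝ → Connection (EuclideanSpace ℝ (Fin 4)) 𝔸 := fun t x => ιL (u' t x) with hudef
  have hslice : ∀ t ∈ Ico (0 : ℝ) ε, ContDiff ℝ ∞ (u' t) := fun t ht => by
    have : u' t = (fun p : ℝ × EuclideanSpace ℝ (Fin 4) => u' p.1 p.2) ∘ fun x => (t, x) := rfl
    rw [this]
    exact hu's.comp_contDiff (contDiff_const.prodMk contDiff_id) fun x => ⟨ht, mem_univ x⟩
  have hD1 : ∀ t ∈ Ico (0 : ℝ) ε, ∀ x, fderiv ℝ (u t) x = ιLL (fderiv ℝ (u' t) x) := by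
    intro t ht x
    exact fderiv_clm_postcomp ιL (((hslice t ht).differentiable (by simp)) x)
  have hD2 : ∀ t ∈ Ico (0 : ℝ) ε, ∀ x w w' v, fderiv ℝ (fderiv ℝ (u t)) x w w' v =
      (fderiv ℝ (fderiv ℝ (u' t)) x w w' v : 𝔸) := by
    intro t ht x w w' v
    have h := fderiv_fderiv_clm_postcomp_apply ιL ((hslice t ht).of_le
      (WithTop.coe_le_coe.mpr le_top)) x w w'
    have h' := congrArg (fun T => T v) h
    simpa only [hιL_apply] using h'
  refine ⟨ε, hε, u, ?_, ?_, ?_, ?_, ?_⟩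
  · -- initial value
    funext x
    show ιL (u' 0 x) = u₀ x
    rw [hu'0]
    exact hιπ (u₀ x) (hu₀v x)
  · exact ιL.contDiff.comp_contDiffOn hu's
  · intro t ht0 ht x i
    show ιL (u' t (x + EuclideanSpace.single i L)) = ιL (u' t x)
    rw [hu'p t ht0 ht x i]
  · intro t _ _ x v
    show ((u' t x v : 𝔤) : 𝔸) ∈ 𝔤
    exact (u' t x v).2
  · intro t ht0 ht x v
    have ht' : t ∈ Ico (0 : ℝ) ε := ⟨ht0.le, ht⟩
    -- the time derivative of the re-embedded solution
    have hU : IsOpen (Ioo (0 : ℝ) ε ×ˢ (univ : Set (EuclideanSpace ℝ (Fin 4)))) :=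
      isOpen_Ioo.prod isOpen_univ
    have hdiff : DifferentiableAt ℝ (fun s => u' s x) t := by
      have hd : DifferentiableAt ℝ (fun p : ℝ × EuclideanSpace ℝ (Fin 4) => u' p.1 p.2) (t, x) :=
        ((hu's.mono (prod_mono Ioo_subset_Ico_self le_rfl)).differentiableOn (by simp)).differentiableAt
          (hU.mem_nhds ⟨⟨ht0, ht⟩, mem_univ x⟩)
      have h1 : DifferentiableAt ℝ (fun s : ℝ => ((s, x) : ℝ × EuclideanSpace ℝ (Fin 4))) t :=
        differentiableAt_id.prodMk (differentiableAt_const x)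
      exact hd.comp t h1
    set Λ : (EuclideanSpace ℝ (Fin 4) →L[ℝ] 𝔤) →L[ℝ] 𝔸 :=
      (ContinuousLinearMap.apply ℝ 𝔸 v).comp ιL with hΛ
    have hΛ_apply : ∀ a : EuclideanSpace ℝ (Fin 4) →L[ℝ] 𝔤, Λ a = (a v : 𝔸) := fun a => rfl
    have hderiv : deriv (fun s => u s x v) t = Λ (deriv (fun s => u' s x) t) := by
      have h := (Λ.hasFDerivAt.comp_hasDerivAt t hdiff.hasDerivAt).deriv
      exact h
    rw [hderiv, hu'pde t ht0 ht x, map_add, map_sum]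
    congr 1
    · rw [sum_apply]
      refine Finset.sum_congr rfl fun i _ => ?_
      rw [hΛ_apply, hD2 t ht' x]
    · -- the nonlinearity: `ι (π (f …) v) = f … v` on `𝔤`-valued jets
      have hval : ∀ w, u t x w ∈ 𝔤 := fun w => (u' t x w).2
      have hjet : ∀ w w', fderiv ℝ (u t) x w w' ∈ 𝔤 := by
        intro w w'
        rw [hD1 t ht' x, hιLL_apply]
        exact (fderiv ℝ (u' t) x w w').2
      have hid := hιπ (f (x, u t x, fderiv ℝ (u t) x)) (hfg x (u t x) (fderiv ℝ (u t) x) hval hjet)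
      have hJ : ((x, ιL (u' t x), ιLL (fderiv ℝ (u' t) x)) : EuclideanSpace ℝ (Fin 4) ×
          (EuclideanSpace ℝ (Fin 4) →L[ℝ] 𝔸) ×
          (EuclideanSpace ℝ (Fin 4) →L[ℝ] EuclideanSpace ℝ (Fin 4) →L[ℝ] 𝔸)) =
          (x, u t x, fderiv ℝ (u t) x) :=
        Prod.ext rfl (Prod.ext rfl (hD1 t ht' x).symm)
      have h1 : Λ (f' (x, u' t x, fderiv ℝ (u' t) x)) = ιL (πL (f (x, u t x, fderiv ℝ (u t) x))) v := by
        rw [← hJ]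
        rfl
      rw [h1, hid]

end SubspaceFree




/-! ### Short-time existence and the named fact from the textbook semilinear hypothesis -/

section Torus

open scoped Matrix.Norms.Frobenius

/-- **`Waldron2019_yangMillsFlow_flatTorus` from the textbook semilinear heat theorem and Waldron's
Thm. 1.1 verbatim.** Hypothesis `hSL`: **local well-posedness of semilinear heat systems on the
flat torus** — for every finite-dimensional real normed space `V`, every smooth nonlinearity
`f(x, u, ∂u)` which is `L`-periodic in `x`, and every smooth `L`-periodic `u₀ : ℝ⁴ → V`, the
system `∂ₜ u = Σ_μ ∂_μ∂_μ u + f(x, u, ∂u)` has a solution `u`, jointly smooth on `[0, ε) × ℝ⁴` for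
some `ε > 0`, `L`-periodic, with `u(0) = u₀` (Taylor, *PDE III*, Ch. 15, §1). Hypothesis `hW`:
Waldron 2019, Thm. 1.1 on the closed flat torus, with (1.1) as a premise and "`lim_{t→T} A(t)`
exists in `C^∞_loc`" as the conclusion. Everything else is proved in this directory: the
invariant-subspace clause (`semilinearHeat_subspace_of_free`), the DeTurck trick
(`shortTime_of_semilinearHeat_coord`), hypothesis (1.1) (`energyHypothesis_of_classical`), the
smooth extension to `[0, T]` (`contDiffOn_Icc_of_smoothLimit`), Cor. 1.2 by restart, junction and
Zorn (`Waldron2019_yangMillsFlow_flatTorus_of_shortTime_of_smoothExtension`) and the flow-line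
packaging (`Waldron2019_yangMillsFlow_flatTorus_of_pde`).
[cite: Waldron2019, §1 (1.1), Thm. 1.1, Cor. 1.2, p. 3] [cite: TaylorPDEIII2011, Ch. 15, §1]
[cite: Struwe1994, §4.1] [cite: DonaldsonKronheimer1990, §6.3.1] -/
theorem Waldron2019_yangMillsFlow_flatTorus_of_semilinearHeatFree_of_thm11
    (hSL : ∀ {V : Type} [NormedAddCommGroup V] [NormedSpace ℝ V] [FiniteDimensional ℝ V]
      (L : ℝ), 0 < L →
      ∀ f : EuclideanSpace ℝ (Fin 4) × V × (EuclideanSpace ℝ (Fin 4) →L[ℝ] V) → V,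
        ContDiff ℝ ∞ f →
        (∀ (x : EuclideanSpace ℝ (Fin 4)) (i : Fin 4) (a : V) (p : EuclideanSpace ℝ (Fin 4) →L[ℝ] V),
          f (x + EuclideanSpace.single i L, a, p) = f (x, a, p)) →
        ∀ u₀ : EuclideanSpace ℝ (Fin 4) → V, ContDiff ℝ ∞ u₀ →
          (∀ (x : EuclideanSpace ℝ (Fin 4)) (i : Fin 4), u₀ (x + EuclideanSpace.single i L) = u₀ x) →
          ∃ ε : ℝ, 0 < ε ∧ ∃ u : ℝ → EuclideanSpace ℝ (Fin 4) → V,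
            u 0 = u₀ ∧
            ContDiffOn ℝ ∞ (fun p : ℝ × EuclideanSpace ℝ (Fin 4) => u p.1 p.2) (Ico 0 ε ×ˢ univ) ∧
            (∀ t : ℝ, 0 ≤ t → t < ε → ∀ (x : EuclideanSpace ℝ (Fin 4)) (i : Fin 4),
              u t (x + EuclideanSpace.single i L) = u t x) ∧
            ∀ t : ℝ, 0 < t → t < ε → ∀ x : EuclideanSpace ℝ (Fin 4),
              deriv (fun s => u s x) t =
                (∑ i, fderiv ℝ (fderiv ℝ (u t)) x (EuclideanSpace.basisFun (Fin 4) ℝ i)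
                  (EuclideanSpace.basisFun (Fin 4) ℝ i)) +
                f (x, u t x, fderiv ℝ (u t) x))
    (hW : ∀ (N : ℕ) (L : ℝ), 0 < L → ∀ T : ℝ, 0 < T →
      ∀ B : ℝ → Connection (EuclideanSpace ℝ (Fin 4)) (Matrix (Fin N) (Fin N) ℂ),
        ContDiffOn ℝ ∞ (fun p : ℝ × EuclideanSpace ℝ (Fin 4) => B p.1 p.2) (Ico 0 T ×ˢ univ) →
        (∀ t : ℝ, 0 ≤ t → t < T → (B t).IsLatticePeriodic L) →
        (∀ t : ℝ, 0 < t → t < T →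
          (B t).IsValuedIn (skewAdjoint.submodule ℝ (Matrix (Fin N) (Fin N) ℂ))) →
        (∀ t : ℝ, 0 < t → t < T → ∀ x v : EuclideanSpace ℝ (Fin 4),
          deriv (fun s => B s x v) t = divCurvature (B t) x v) →
        (∃ C : ℝ, ∀ t ∈ Ico 0 T,
          ∫ y in {y | WithLp.ofLp y ∈ Icc (0 : Fin 4 → ℝ) (fun i => (0 : Fin 4 → ℝ) i + L)},
            ymDensityOfBasis (EuclideanSpace.basisFun _ ℝ) (B t) y ≤ C) →
        (∃ C : ℝ, ∀ t₁ t₂ : ℝ, 0 < t₁ → t₁ ≤ t₂ → t₂ < T →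
          2 * ∫ s in t₁..t₂,
            ∫ y in {y | WithLp.ofLp y ∈ Icc (0 : Fin 4 → ℝ) (fun i => (0 : Fin 4 → ℝ) i + L)},
              ∑ j, ‖divCurvature (B s) y (EuclideanSpace.basisFun _ ℝ j)‖ ^ 2 ≤ C) →
        ∃ B_T : Connection (EuclideanSpace ℝ (Fin 4)) (Matrix (Fin N) (Fin N) ℂ),
          IsSmoothConnection B_T ∧
          ∀ n : ℕ, TendstoLocallyUniformly (fun t y => iteratedFDeriv ℝ n (B t) y)
            (iteratedFDeriv ℝ n B_T) (𝓝[<] T)) :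
    Waldron2019_yangMillsFlow_flatTorus :=
  Waldron2019_yangMillsFlow_flatTorus_of_semilinearHeatCoord_of_thm11
    (fun 𝔤 L hL f hf hfp hfg u₀ hu₀ hu₀v hu₀p =>
      semilinearHeat_subspace_of_free hSL 𝔤 L hL f hf hfp hfg u₀ hu₀ hu₀v hu₀p)
    hW

end Torus

end Literature.MathematicalPhysics.QuantumLattice
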